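import Literature.Barriers.Parity.SiegelZeroDichotomyPairHLPsiFourier
import HarnessLib

/-!
# Tao–Teräväinen 2022, §8 (`k = 2`): preliminaries for the assembly of Propositions 7.2 and 8.1

Topic `Literature/Barriers/Parity`, sub-namespace `TaoTeravainen`; part of the proof DAG of
`Literature.Barriers.Parity.TaoTeravainen2021_prop72_81_pair` (T. Tao, J. Teräväinen, *The
Hardy–Littlewood–Chowla conjecture in the presence of a Siegel zero*, J. London Math. Soc. (2) 106
(2022), arXiv:2109.06291). Proposition 7.2: "`𝔼_{n≤x} Λ_Siegel(n+h₁)⋯Λ_Siegel(n+h_k) ≈ 𝔼_{n≤x}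
Λ♯_Siegel(n+h₁)⋯Λ♯_Siegel(n+h_k)`. We write `Λ_Siegel = Λ♯_Siegel + Λ♭_Siegel` … it suffices to show
that `𝔼 Λ♭(n+h₁)Λ_Siegel(n+h₂) ≈ 0` and `𝔼 Λ♭(n+h₁)Λ♯(n+h₂) ≈ 0`"; and the pointwise form (8.8) of
Proposition 8.1 is used for `x^{1−ε₀²} ≤ y ≤ x`, where "`ψ(log(x/t)/(2 log Dq²))` equals to `1` on the
support of `φ'(log((y+h_j)/t))`". Everything here is PROVED and elementary:

* `pairSum_eq_sharp_add_flat_terms` — the algebraic decomposition of `∑ Λ_S(n+h₁)Λ_S(n+h₂)` into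
  `∑ Λ♯Λ♯` and the three `Λ♭`-terms, and `abs_pairSum_sub_sharpSum_le` — the three terms bounded by a
  Proposition 7.2–type hypothesis (for the ordered pairs `(h₁,h₂)` and `(h₂,h₁)`);
* `psiLog_eq_self_of_mem` — in the bulk (`X − U₀ + 1 ≤ c − δ`, `c + δ ≤ X + U₀ − 1`, `3U₀ ≤ X`) the
  profile `psiLog` is the identity on `(c−δ, c+δ)` (the hypothesis of `integral_psiFourier_mul_eq_one`);
* `psiSharp_exp_sub_log_eq_zero_of_lt` — `Ψ(e^{c − log d}) = 0` once `d > e^{c − X + 2U₀ + 1}`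
  (the hypothesis `hΨ` of the six-slot and Möbius-slot files);
* `flatParams` — for `X ≥ 20`, `log q ≤ X/20`, `0 < ε₀ ≤ 1/100`, `q ≥ 3`, the scale
  `U₀ = ε₀X/20 + 2 log q` satisfies `2 ≤ U₀`, `3U₀ ≤ X`, `2U₀ + 2 ≤ X`.
  [cite: TaoTeravainen2021, Proposition 7.2 (proof, first paragraph); §8 (8.8) and Lemma 8.2 (proof of (8.16))]
-/

noncomputable section

open Finset Real

namespace Literature.Barriers.Parity

namespace TaoTeravainen

variable {q : ℕ}

/-! ### The decomposition `Λ_S Λ_S = Λ♯Λ♯ + Λ♭Λ_S + Λ_SΛ♭ − Λ♭Λ♭` -/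

/-- **The algebraic decomposition of the pair sum** (`Λ_S = Λ♯ + Λ♭` in both slots):
`∑ Λ_S(n+h₁)Λ_S(n+h₂) = ∑ Λ♯(n+h₁)Λ♯(n+h₂) + ∑ Λ♭(n+h₁)Λ_S(n+h₂) + ∑ Λ♭(n+h₂)Λ_S(n+h₁) − ∑ Λ♭(n+h₁)Λ♭(n+h₂)`.
[cite: TaoTeravainen2021, Proposition 7.2 (proof: "We write `Λ_Siegel = Λ♯_Siegel + Λ♭_Siegel` for all of
the `k` factors")] -/
theorem pairSum_eq_sharp_add_flat_terms (χ : DirichletCharacter ℂ q) (φ ψ : ℝ → ℝ) (X U₀ R : ℝ)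
    (S : Finset ℕ) (h₁ h₂ : ℕ) :
    ∑ n ∈ S, vonMangoldtSiegel χ ψ R (n + h₁) * vonMangoldtSiegel χ ψ R (n + h₂) =
      ∑ n ∈ S, vonMangoldtSiegelSharp χ φ ψ X U₀ R (n + h₁) * vonMangoldtSiegelSharp χ φ ψ X U₀ R (n + h₂) +
        (∑ n ∈ S, vonMangoldtSiegelFlat χ φ ψ X U₀ R (n + h₁) * vonMangoldtSiegel χ ψ R (n + h₂) +
          ∑ n ∈ S, vonMangoldtSiegelFlat χ φ ψ X U₀ R (n + h₂) * vonMangoldtSiegel χ ψ R (n + h₁) -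
          ∑ n ∈ S, vonMangoldtSiegelFlat χ φ ψ X U₀ R (n + h₁) * vonMangoldtSiegelFlat χ φ ψ X U₀ R (n + h₂)) := by
  rw [← sum_add_distrib, ← sum_sub_distrib, ← sum_add_distrib]
  refine sum_congr rfl fun n _ => ?_
  rw [vonMangoldtSiegel_eq_sharp_add_flat χ φ ψ X U₀ R (n + h₁),
    vonMangoldtSiegel_eq_sharp_add_flat χ φ ψ X U₀ R (n + h₂)]
  ring

/-- **The three `Λ♭`-terms are small under Proposition 7.2**: if the two ordered-pair bounds hold
(`|∑Λ♭(n+h)Λ_S(n+h')|, |∑Λ♭(n+h)Λ♭(n+h')| ≤ E` for `(h,h') = (h₁,h₂)` and `|∑Λ♭(n+h₂)Λ_S(n+h₁)| ≤ E`), then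
`|∑ Λ_S(n+h₁)Λ_S(n+h₂) − ∑ Λ♯(n+h₁)Λ♯(n+h₂)| ≤ 3E`. [cite: TaoTeravainen2021, Proposition 7.2] -/
theorem abs_pairSum_sub_sharpSum_le (χ : DirichletCharacter ℂ q) (φ ψ : ℝ → ℝ) (X U₀ R : ℝ)
    (S : Finset ℕ) (h₁ h₂ : ℕ) {E : ℝ}
    (hA : |∑ n ∈ S, vonMangoldtSiegelFlat χ φ ψ X U₀ R (n + h₁) * vonMangoldtSiegel χ ψ R (n + h₂)| ≤ E)
    (hB : |∑ n ∈ S, vonMangoldtSiegelFlat χ φ ψ X U₀ R (n + h₂) * vonMangoldtSiegel χ ψ R (n + h₁)| ≤ E)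
    (hC : |∑ n ∈ S, vonMangoldtSiegelFlat χ φ ψ X U₀ R (n + h₁) * vonMangoldtSiegelFlat χ φ ψ X U₀ R (n + h₂)| ≤ E) :
    |∑ n ∈ S, vonMangoldtSiegel χ ψ R (n + h₁) * vonMangoldtSiegel χ ψ R (n + h₂) -
        ∑ n ∈ S, vonMangoldtSiegelSharp χ φ ψ X U₀ R (n + h₁) * vonMangoldtSiegelSharp χ φ ψ X U₀ R (n + h₂)| ≤ 3 * E := by
  rw [pairSum_eq_sharp_add_flat_terms χ φ ψ X U₀ R S h₁ h₂, add_sub_cancel_left]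
  calc _ ≤ |∑ n ∈ S, vonMangoldtSiegelFlat χ φ ψ X U₀ R (n + h₁) * vonMangoldtSiegel χ ψ R (n + h₂) +
          ∑ n ∈ S, vonMangoldtSiegelFlat χ φ ψ X U₀ R (n + h₂) * vonMangoldtSiegel χ ψ R (n + h₁)| +
          |∑ n ∈ S, vonMangoldtSiegelFlat χ φ ψ X U₀ R (n + h₁) * vonMangoldtSiegelFlat χ φ ψ X U₀ R (n + h₂)| :=
        abs_sub _ _
    _ ≤ (E + E) + E := add_le_add ((abs_add_le _ _).trans (add_le_add hA hB)) hC
    _ = 3 * E := by ring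

/-! ### The bulk: `psiLog` is the identity near `c` -/

/-- **In the bulk the profile is the identity**: for `0 < U₀`, `3U₀ ≤ X`, `X − U₀ + 1 ≤ c − δ` and
`c + δ ≤ X + U₀ − 1`, `psiLog(w) = w` for `w ∈ (c−δ, c+δ)` (`Ψ(e^w) = log e^w = w` there).
[cite: TaoTeravainen2021, proof of Lemma 8.2 ("equals to `1` on the support of `φ'`")] -/
theorem psiLog_eq_self_of_mem {φ ψ : ℝ → ℝ} (hφ : IsBump φ) (hψ : IsSmoothCutoff ψ) {X U₀ : ℝ}
    (hU₀ : 0 < U₀) (hX3 : 3 * U₀ ≤ X) {c δ : ℝ} (hlo : X - U₀ + 1 ≤ c - δ) (hhi : c + δ ≤ X + U₀ - 1)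
    {w : ℝ} (hw : w ∈ Set.Ioo (c - δ) (c + δ)) : psiLog φ ψ X U₀ w = w := by
  rw [Set.mem_Ioo] at hw
  rw [← psiSharp_exp_eq_psiLog φ hψ hU₀ hX3 w,
    psiSharp_eq_log hφ hψ hU₀ (by linarith) (by rw [Real.log_exp]; linarith) (by rw [Real.log_exp]; linarith),
    Real.log_exp]

/-! ### The support of `d ↦ Ψ(e^{c − log d})` -/

/-- **`Ψ(e^{c − log d}) = 0` for `d > e^{c − X + 2U₀ + 1}`** (`U₀ > 0`, `d ≥ 1`). [cite: TaoTeravainen2021,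
§8 ("the restrictions on `d₁,…,d_k` can be dropped thanks to the support of the `Ψ_{d_j}`")] -/
theorem psiSharp_exp_sub_log_eq_zero_of_lt {φ ψ : ℝ → ℝ} (hφ : IsBump φ) (hψ : IsSmoothCutoff ψ)
    {X U₀ : ℝ} (hU₀ : 0 < U₀) {c : ℝ} {d : ℕ} (hd : Real.exp (c - X + 2 * U₀ + 1) < d) :
    psiSharp φ ψ X U₀ (Real.exp (c - Real.log d)) = 0 := by
  have hd0 : (0 : ℝ) < d := (Real.exp_pos _).trans hd
  refine psiSharp_eq_zero hφ hψ hU₀ ?_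
  rw [Real.log_exp]
  have : c - X + 2 * U₀ + 1 < Real.log d := by
    rw [Real.lt_log_iff_exp_lt hd0]; exact hd
  linarith

/-- The same for the quotient `(y + h)/d` with `c = log(y+h)`, `y + h > 0`. [folklore] -/
theorem psiSharp_div_eq_zero_of_lt {φ ψ : ℝ → ℝ} (hφ : IsBump φ) (hψ : IsSmoothCutoff ψ)
    {X U₀ : ℝ} (hU₀ : 0 < U₀) {Y : ℝ} (hY : 0 < Y) {d : ℕ} (hd : Real.exp (Real.log Y - X + 2 * U₀ + 1) < d) :
    psiSharp φ ψ X U₀ (Y / d) = 0 := by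
  have hd0 : (0 : ℝ) < d := (Real.exp_pos _).trans hd
  have : Y / d = Real.exp (Real.log Y - Real.log d) := by
    rw [Real.exp_sub, Real.exp_log hY, Real.exp_log hd0]
  rw [this]
  exact psiSharp_exp_sub_log_eq_zero_of_lt hφ hψ hU₀ hd

/-! ### The parameters `X = log x`, `U₀ = log(Dq²) = ε₀X/20 + 2 log q` -/

/-- **The flat scale is admissible**: for `X ≥ 20`, `log q ≤ X/20`, `3 ≤ q`, `0 < ε₀ ≤ 1/100`, the scale
`U₀ = ε₀X/20 + 2 log q` satisfies `2 ≤ U₀`, `3U₀ ≤ X` and `2U₀ + 2 ≤ X`. [cite: TaoTeravainen2021, §7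
((7.3): `D = x^{ε₀/20}`) and §2.4 (the ranges (2.3)–(2.6))] -/
theorem flatParams {X ε₀ : ℝ} {q : ℕ} (hX : 20 ≤ X) (hq : 3 ≤ q) (hlogq : Real.log q ≤ X / 20)
    (hε₀ : 0 < ε₀) (hε₀1 : ε₀ ≤ 1 / 100) :
    2 ≤ ε₀ / 20 * X + 2 * Real.log q ∧ 3 * (ε₀ / 20 * X + 2 * Real.log q) ≤ X ∧
      2 * (ε₀ / 20 * X + 2 * Real.log q) + 2 ≤ X := by
  have hlog3 : 1 ≤ Real.log q := by
    have h3 : Real.log 3 ≤ Real.log q := Real.log_le_log (by norm_num) (by exact_mod_cast hq)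
    have : 1 ≤ Real.log 3 := by
      rw [← Real.log_exp 1]
      refine Real.log_le_log (Real.exp_pos 1) ?_
      have := Real.exp_one_lt_d9; linarith
    linarith
  have hεX : ε₀ / 20 * X ≤ X / 2000 := by nlinarith
  have hεX0 : 0 ≤ ε₀ / 20 * X := by positivity
  refine ⟨by linarith, by linarith, by linarith⟩

end TaoTeravainen

end Literature.Barriers.Parity
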